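import Mathlib
import Summits.NavierStokesRegularity.NavierStokesRegularity.Theorems.TaoLadderRungTwoBreakOneShiftSparseFrame
import Summits.NavierStokesRegularity.NavierStokesRegularity.Theorems.TaoLadderRungTwoBreakOneShiftCentre
import HarnessLib

/-!
# The one-shift Banach argument: closed-form frame, one hull of `g`, TABLE-SPARSE rates (`v7s`)

The end of the kernel STAGE-3 chain in the form the STAGE-2/3 certificates of the cell can instantiate.
`exists_surviving_dssWave_of_windowCert_v7s` = `exists_surviving_dssWave_of_windowCert_v7` (closed-form frame,
a single two-sided hull `g ∈ [g_lo, g_hi]` of the renormalisation factor, non-emptiness by the centre point)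
over the table-sparse assembly `exists_surviving_dssWave_of_windowCert_v5s`: the time-Lipschitz rate function
of the tails is pinned off the window to `R (-j-1) = (S Q² β²)(β²/Λ)^{j+1}`, `R (W+j) = (S ā_t² Λ^W)(Λ ϑ_R²)^j`
with `S ≥ Σ_{i₁,i₂,μ} |α_{i₁i₂iμ}|` (every `i`), instead of the norm bound `4 m² M_α (…)` of `v5 … v7`, which the
wake self-map rows of the certificates cannot meet.  HYPOTHESIS LEDGER (nothing over all `k ∈ ℤ` except
closed-form equalities): certificate side — `cert`, `hWedge/hγedge/hZedge/hDedge` (edge-form Lipschitz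
numbers), `hwinIn` (Krawczyk), `hAwin` (window amplitude hulls), `hgl` (hull of `g`), `hA1` (wake-entry
deviation); frame side — `hR0, hRW, hRT, hwtW, htubeRW, htubeCW, hAW, hwtT, htubeRT, htubeCT, hAT`; scalars;
nine finite rows `hRBm1, hRBW, hfirstW, hfirstWS, hfirstT, hfirstTS, hrowB, hrowT, hrow1`.  Model lattice only
(Tao-type averaged cascade); nothing here is about Navier–Stokes.
[cite: Tao2016AveragedNS, §4 Lemma 4.1 (4.8), §5.3–§6; cell vocabulary, harvest/h2-tao-ladder
rung1/KERNEL-STAGE3-PLAN.md §6, rung1/STAGE2-LEMMA.md §5, rung1/INSTANCE-SHEET-T4-0.1-W76.md]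
-/

noncomputable section

namespace Summit.NavierStokesRegularity.NavierStokesRegularity.Theorems

namespace DSSOneShift

open Set MeasureTheory intervalIntegral
open Literature.Analysis.FluidPDE Literature.Analysis.FluidPDE.TaoCascade CertificateGlueOn

variable {m : ℕ}

namespace OneShiftFrame

variable (F : OneShiftFrame m)

/-- **The one-shift Banach argument on the closed-form frame, one hull of `g`, TABLE-SPARSE rates.**  As
`exists_surviving_dssWave_of_windowCert_v7` but over `exists_surviving_dssWave_of_windowCert_v5s`: the rate function is pinned off the
window to the geometric envelopes of the table-sparse functional `quadTermLip (A, A) / 2` (`hRW`, `hRT`, `S ≥ Σ|α|_i`), with the two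
boundary rate rows `hRBm1` (`k = -1`), `hRBW` (`k = W`) as finite hypotheses and `hR0 : 0 ≤ R`.  Otherwise as `v7`: compared with `v6`, with its four certificate-side statements about the
renormalisation factor and the invariant set (`hg0, hη, hg, h0`) replaced by the single hull
`hgl : g_lo ≤ g ≤ g_hi` over the admissible set and the scalar conditions `1 < g_lo`, `g_hi² ≤ 1 + ε₀`,
`g_hi < Λ`, `β² < g_lo Λ`, `g_lo ≤ ĝ ≤ g_hi`; the centre-deviation hull is `η = max (g_hi - ĝ) (ĝ - g_lo)` and the
invariant set is non-empty by `exists_admLip`.  What remains certificate-side: the window certificate `cert`,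
the edge-form Lipschitz numbers `hWedge/hγedge/hZedge/hDedge`, the Krawczyk inclusion `hwinIn`, the window
amplitude hulls `hAwin`, the hull `hgl`, the wake-entry deviation `hA1`; frame-side: the closed-form equalities
and scalar inequalities; and the seven rows `hfirstW, hfirstWS, hfirstT, hfirstTS, hrowB, hrowT, hrow1`.
Conditional glue for the Tao-type shell model only; nothing about Navier–Stokes.
[cite: Tao2016AveragedNS, §4 Lemma 4.1 (4.8), §5.3–§6; cell vocabulary, harvest/h2-tao-ladder
rung1/KERNEL-STAGE3-PLAN.md §6, rung1/STAGE3-BANACH.md §1–§2, rung1/INSTANCE-SHEET-T4-0.1-W76.md] -/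
theorem exists_surviving_dssWave_of_windowCert_v7s {ε₀ Mα Q β q gLo gHi A1 S : ℝ}
    {Z Sb Se γx γb γe dz0 χb χe : ℝ}
    {ω θ κ ωt ϑ abart ϑR εR ghat cmax r₀ δ' : ℝ} {c₀ : Fin m → ℝ}
    {α : Fin m → Fin m → Fin m → ℤ × ℤ × ℤ → ℝ} (cert : OneShiftWindowCert F ε₀ α)
    (R A vmax χbm χem : ℤ → ℝ)
    (hε : 0 < 1 + ε₀) (hΛ1 : 1 ≤ bigLam ε₀) (hMα : 0 ≤ Mα) (hα : ∀ i₁ i₂ i₃ μ, |α i₁ i₂ i₃ μ| ≤ Mα)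
    (hW1 : 1 ≤ F.W) (hq : 0 ≤ q) (hq1 : q < 1) (hA0 : ∀ k, 0 ≤ A k)
    (hAwin : ∀ w, F.Adm w → ∀ j k', F.InWindow k' → ∀ s ∈ Icc 0 F.τhi, |F.fullFamily cert w j k' s| ≤ A k')
    -- the rate function: pinned off the window to the geometric envelopes of `quadTermLip (A, A) / 2`
    -- (`S ≥ Σ|α|_i`); the two boundary rate rows (which read window shells) are finite hypotheses
    (hR0 : ∀ k, 0 ≤ R k) (hS : ∀ i, tableAbsSum α i ≤ S)
    (hRW : ∀ j : ℕ, R (-(j : ℤ) - 1) = (S * Q ^ 2 * β ^ 2) * (β ^ 2 * (bigLam ε₀)⁻¹) ^ (j + 1))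
    (hRT : ∀ j : ℕ, R ((F.W : ℤ) + j) = (S * abart ^ 2 * bigLam ε₀ ^ F.W) * (bigLam ε₀ * ϑR ^ 2) ^ j)
    (hRBm1 : ∀ i, quadTermLip ε₀ α A A i (-1) ≤ 2 * R (-1))
    (hRBW : ∀ i, quadTermLip ε₀ α A A i F.W ≤ 2 * R F.W)
    -- ONE two-sided hull of the renormalisation factor over the admissible set, and scalar conditions on it
    (hgl : ∀ w, F.Adm w → gLo ≤ gfac (slice (F.fullFamily cert w) (F.decodeTau w)) ∧
      gfac (slice (F.fullFamily cert w) (F.decodeTau w)) ≤ gHi)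
    (hgLo1 : 1 < gLo) (hgHi2 : gHi ^ 2 ≤ 1 + ε₀) (hgHiΛ : gHi < bigLam ε₀) (hβgLo : β ^ 2 < gLo * bigLam ε₀)
    (hĝlo : gLo ≤ ghat) (hĝgHi : ghat ≤ gHi)
    -- window side, EDGE FORM (the engine's STAGE3 lines)
    (hWedge : ∀ u v, F.AdmLip R u → F.AdmLip R v → ∀ B E : ℝ,
      (∀ i, ∀ t ∈ Icc 0 F.τhi, |F.decodeTail u i (-1) t - F.decodeTail v i (-1) t| ≤ B) →
      (∀ i, ∀ t ∈ Icc 0 F.τhi, |F.decodeTail u i F.W t - F.decodeTail v i F.W t| ≤ E) →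
        dist (F.rawWindow cert u) (F.rawWindow cert v) ≤ Z * dist u v + Sb * B + Se * E)
    (hγedge : ∀ u v, F.AdmLip R u → F.AdmLip R v → ∀ B E : ℝ,
      (∀ i, ∀ t ∈ Icc 0 F.τhi, |F.decodeTail u i (-1) t - F.decodeTail v i (-1) t| ≤ B) →
      (∀ i, ∀ t ∈ Icc 0 F.τhi, |F.decodeTail u i F.W t - F.decodeTail v i F.W t| ≤ E) →
        |gfac (slice (F.fullFamily cert u) (F.decodeTau u)) -
          gfac (slice (F.fullFamily cert v) (F.decodeTau v))| ≤ γx * dist u v + γb * B + γe * E)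
    (hZedge : ∀ u v, F.AdmLip R u → F.AdmLip R v → ∀ i, ∀ B E : ℝ,
      (∀ i, ∀ t ∈ Icc 0 F.τhi, |F.decodeTail u i (-1) t - F.decodeTail v i (-1) t| ≤ B) →
      (∀ i, ∀ t ∈ Icc 0 F.τhi, |F.decodeTail u i F.W t - F.decodeTail v i F.W t| ≤ E) →
        |F.fullFamily cert u i 0 (F.decodeTau u) - F.fullFamily cert v i 0 (F.decodeTau v)| ≤
          dz0 * dist u v + χb * B + χe * E)
    (hDedge : ∀ u v, F.AdmLip R u → F.AdmLip R v → ∀ j k', F.InWindow k' → ∀ s ∈ Icc 0 F.τhi, ∀ B E : ℝ,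
      (∀ i, ∀ t ∈ Icc 0 F.τhi, |F.decodeTail u i (-1) t - F.decodeTail v i (-1) t| ≤ B) →
      (∀ i, ∀ t ∈ Icc 0 F.τhi, |F.decodeTail u i F.W t - F.decodeTail v i F.W t| ≤ E) →
        |F.fullFamily cert u j k' s - F.fullFamily cert v j k' s| ≤ vmax k' * dist u v + χbm k' * B + χem k' * E)
    (hqX : Z + Sb * F.wt (-1) + Se * F.wt F.W ≤ q)
    (hDwin0 : ∀ k', F.InWindow k' → 0 ≤ vmax k' + χbm k' * F.wt (-1) + χem k' * F.wt F.W)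
    (hγ0 : 0 ≤ γx + γb * F.wt (-1) + γe * F.wt F.W)
    -- the closed-form frame: wake side
    (hθ : 1 ≤ θ) (hβ1 : 1 ≤ β) (hβθ : β ≤ θ) (hβΛ : β ≤ bigLam ε₀) (hω : 0 ≤ ω)
    (hδ' : 0 < δ') (hβge : gHi * (1 + δ') ≤ β) (hr₀ : 0 ≤ r₀) (hκ : 0 ≤ κ) (hc : ∀ i, |c₀ i| ≤ cmax)
    (hQ : cmax + r₀ + κ / δ' ≤ Q) (hσξ : β ^ 2 * (bigLam ε₀)⁻¹ ≤ gHi)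
    (hwtW : ∀ n : ℕ, F.wt (-(n : ℤ) - 1) = ω * θ ^ (n + 1))
    (htubeRW : ∀ n : ℕ, F.tubeR (-(n : ℤ) - 1) = gHi ^ (n + 1) * (r₀ + κ * ((n : ℝ) + 1)))
    (htubeCW : ∀ i (n : ℕ), F.tubeC i (-(n : ℤ) - 1) = ghat ^ (n + 1) * c₀ i)
    (hAW : ∀ n : ℕ, A (-(n : ℤ) - 1) = Q * β ^ (n + 1))
    -- the closed-form frame: above the window
    (hϑ0 : 0 < ϑ) (hϑ1 : ϑ ≤ 1) (hϑR : 0 < ϑR) (hϑRϑ : ϑR ≤ ϑ) (hϑRΛ : ϑR * bigLam ε₀ < 1) (hωt : 0 ≤ ωt)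
    (hAlast : A ((F.W : ℤ) - 1) ≤ abart) (hεab : εR ≤ abart * ϑR)
    (hwtT : ∀ j : ℕ, F.wt ((F.W : ℤ) + j) = ωt * ϑ ^ j)
    (htubeRT : ∀ j : ℕ, F.tubeR ((F.W : ℤ) + j) = εR * ϑR ^ j)
    (htubeCT : ∀ i (j : ℕ), F.tubeC i ((F.W : ℤ) + j) = 0)
    (hAT : ∀ j : ℕ, A ((F.W : ℤ) + j) = εR * ϑR ^ j)
    -- the seven rows
    (hfirstW : ∀ i, gHi * (ω * θ + (S * Q ^ 2 * β ^ 2) * (β ^ 2 * (bigLam ε₀)⁻¹) * F.rτ) +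
      Q * β * (γx + γb * F.wt (-1) + γe * F.wt F.W) +
      F.τhi * (2 * tableAbsSum α i * (bigLam ε₀)⁻¹ ^ 2 * (ω * θ ^ 3) * (Q * β ^ 3)) ≤ q * (ω * θ ^ 2))
    (hfirstWS : cmax * max (gHi - ghat) (ghat - gLo) * ghat +
      F.τhi * ((S * Q ^ 2 * β ^ 2) * (β ^ 2 * (bigLam ε₀)⁻¹) ^ 2) ≤ κ * gHi ^ 2)
    (hfirstT : ∀ i, gHi * (ωt * ϑ ^ 2 +
        (S * abart ^ 2 * bigLam ε₀ ^ F.W) * (bigLam ε₀ * ϑR ^ 2) ^ 2 * F.rτ) +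
      (abart * ϑR) * ϑR ^ 2 * (γx + γb * F.wt (-1) + γe * F.wt F.W) +
      F.τhi * (2 * tableAbsSum α i * bigLam ε₀ ^ (F.W + 1) * ωt * (abart * ϑR)) ≤ q * (ωt * ϑ))
    (hfirstTS : gHi * (εR * ϑR) + F.τhi * (S * abart ^ 2 * bigLam ε₀ ^ F.W) ≤ εR)
    (hrowB : ∀ i, gHi * (dz0 + χb * F.wt (-1) + χe * F.wt F.W) + A 0 * (γx + γb * F.wt (-1) + γe * F.wt F.W) +
      F.τhi * quadTermLip ε₀ α A
        (fun k' => if F.InWindow k' then vmax k' + χbm k' * F.wt (-1) + χem k' * F.wt F.W else F.wt k') i (-1) ≤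
        q * F.wt (-1))
    (hrowT : ∀ i, gHi * (F.wt ((F.W : ℤ) + 1) + R ((F.W : ℤ) + 1) * F.rτ) +
      A ((F.W : ℤ) + 1) * (γx + γb * F.wt (-1) + γe * F.wt F.W) +
      F.τhi * quadTermLip ε₀ α A
        (fun k' => if F.InWindow k' then vmax k' + χbm k' * F.wt (-1) + χem k' * F.wt F.W else F.wt k') i F.W ≤
        q * F.wt F.W)
    (hrow1 : A1 + F.τhi * R (-1) ≤ F.tubeR (-1))
    -- the rest as in `v4` / `v5` / `v6`
    (hwinIn : ∀ u, F.AdmLip R u →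
      (∀ i k, |(F.rawWindow cert u).1 i k| ≤ 1) ∧ |(F.rawWindow cert u).2| ≤ 1)
    (hA1 : ∀ w, F.Adm w → ∀ i,
      |gfac (slice (F.fullFamily cert w) (F.decodeTau w)) * F.fullFamily cert w i 0 (F.decodeTau w) -
        F.tubeC i (-1)| ≤ A1)
    (hQA : A 0 ≤ Q) (hne : ∃ i, F.a i 0 < |F.yc i 0|) :
    ∃ (T : ℝ) (Φ : Unit → ℝ → Em m), 0 < T ∧ IsDSSWave ε₀ α (Equiv.refl Unit) T Φ ∧ Surviving 1 ε₀ T ∧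
      ∃ x, Φ () x ≠ 0 := by
  have hΛpos : 0 < bigLam ε₀ := lt_of_lt_of_le one_pos hΛ1
  have hgLo0 : 0 ≤ gLo := by linarith
  have hĝ0 : 0 < ghat := by linarith
  have hg0 : ∀ w, F.Adm w → 0 ≤ gfac (slice (F.fullFamily cert w) (F.decodeTau w)) ∧
      gfac (slice (F.fullFamily cert w) (F.decodeTau w)) ≤ gHi :=
    fun w hw => ⟨hgLo0.trans (hgl w hw).1, (hgl w hw).2⟩
  have hη : ∀ w, F.Adm w →
      |gfac (slice (F.fullFamily cert w) (F.decodeTau w)) - ghat| ≤ max (gHi - ghat) (ghat - gLo) := by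
    intro w hw
    obtain ⟨h1, h2⟩ := hgl w hw
    have hl := le_max_left (gHi - ghat) (ghat - gLo)
    have hr := le_max_right (gHi - ghat) (ghat - gLo)
    rw [abs_le]
    constructor <;> linarith
  have hg : ∀ u, F.AdmLip R u →
      1 < gfac (slice (F.fullFamily cert u) (F.decodeTau u)) ^ 2 ∧
        gfac (slice (F.fullFamily cert u) (F.decodeTau u)) ^ 2 ≤ 1 + ε₀ ∧
        gfac (slice (F.fullFamily cert u) (F.decodeTau u)) < bigLam ε₀ ∧
        β ^ 2 < gfac (slice (F.fullFamily cert u) (F.decodeTau u)) * bigLam ε₀ := by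
    intro u hu
    obtain ⟨h1, h2⟩ := hgl u hu.1
    have hgpos : 0 ≤ gfac (slice (F.fullFamily cert u) (F.decodeTau u)) := hgLo0.trans h1
    refine ⟨by nlinarith, (pow_le_pow_left₀ hgpos h2 2).trans hgHi2, lt_of_le_of_lt h2 hgHiΛ,
      hβgLo.trans_le (mul_le_mul_of_nonneg_right h1 hΛpos.le)⟩
  have h0 : ∃ u, F.AdmLip R u := F.exists_admLip R fun k _ => hR0 k
  obtain ⟨η, hηdef⟩ : ∃ η : ℝ, η = max (gHi - ghat) (ghat - gLo) := ⟨_, rfl⟩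
  rw [← hηdef] at hη
  have hfirstWSη : cmax * η * ghat +
      F.τhi * ((S * Q ^ 2 * β ^ 2) * (β ^ 2 * (bigLam ε₀)⁻¹) ^ 2) ≤ κ * gHi ^ 2 := by
    rw [hηdef]; exact hfirstWS
  -- signs of the frame constants
  obtain ⟨i₀, -⟩ := id hne
  have hcmax : 0 ≤ cmax := (abs_nonneg _).trans (hc i₀)
  have hgHi : 0 ≤ gHi := hĝ0.le.trans hĝgHi
  have hη0 : 0 ≤ η := by
    obtain ⟨u₀, hu₀⟩ := h0
    exact (abs_nonneg _).trans (hη u₀ hu₀.1)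
  have habar : 0 ≤ Q := le_trans (by positivity : 0 ≤ cmax + r₀ + κ / δ') hQ
  have habart : 0 ≤ abart := (hA0 _).trans hAlast
  have hεR : 0 ≤ εR := by
    have h := F.tubeR_nonneg ((F.W : ℤ) + (0 : ℕ))
    rw [htubeRT 0] at h
    simpa using h
  have hβ0 : 0 ≤ β := by linarith
  have hgβ : gHi ≤ β := le_trans (le_mul_of_one_le_right hgHi (by linarith)) hβge
  have hĝβ : ghat ≤ β := hĝgHi.trans hgβ
  have hdbar : 0 ≤ cmax * η / ghat := by positivity
  have hC₀ : 0 ≤ εR / ϑR ^ F.W := by positivity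
  have hΛϑ : bigLam ε₀ * ϑR ≤ 1 := by rw [mul_comm]; exact hϑRΛ.le
  -- the centre-deviation allowance
  obtain ⟨devC, hdevC⟩ : ∃ devC : ℤ → ℝ,
      devC = fun k => if k < 0 then cmax * η * ghat ^ (-k - 1).toNat else 0 := ⟨_, rfl⟩
  -- the wake tube envelope (affine-geometric ≤ geometric)
  have hwake : ∀ i (n : ℕ), |F.tubeC i (-(n : ℤ) - 1)| + F.tubeR (-(n : ℤ) - 1) ≤ Q * β ^ (n + 1) := by
    intro i n
    rw [htubeCW, htubeRW, abs_mul, abs_of_nonneg (pow_nonneg hĝ0.le _)]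
    have h1 : ghat ^ (n + 1) * |c₀ i| ≤ β ^ (n + 1) * cmax :=
      mul_le_mul (pow_le_pow_left₀ hĝ0.le hĝβ _) (hc i) (abs_nonneg _) (pow_nonneg hβ0 _)
    have h2 : gHi ^ (n + 1) * (r₀ + κ * ((n : ℝ) + 1)) ≤ (r₀ + κ / δ') * β ^ (n + 1) := by
      have h := affineGeom_le_geom hr₀ hκ hgHi hδ' (n + 1)
      push_cast at h
      calc gHi ^ (n + 1) * (r₀ + κ * ((n : ℝ) + 1)) = (r₀ + κ * ((n : ℝ) + 1)) * gHi ^ (n + 1) := by ring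
        _ ≤ (r₀ + κ / δ') * (gHi * (1 + δ')) ^ (n + 1) := h
        _ ≤ (r₀ + κ / δ') * β ^ (n + 1) :=
          mul_le_mul_of_nonneg_left (pow_le_pow_left₀ (by positivity) hβge _) (by positivity)
    calc ghat ^ (n + 1) * |c₀ i| + gHi ^ (n + 1) * (r₀ + κ * ((n : ℝ) + 1))
        ≤ β ^ (n + 1) * cmax + (r₀ + κ / δ') * β ^ (n + 1) := add_le_add h1 h2
      _ = (cmax + r₀ + κ / δ') * β ^ (n + 1) := by ring
      _ ≤ Q * β ^ (n + 1) := mul_le_mul_of_nonneg_right hQ (pow_nonneg hβ0 _)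
  -- the envelope hypotheses of `v5`, derived
  have hAtail : ∀ j k', ¬ F.InWindow k' → |F.tubeC j k'| + F.tubeR k' ≤ A k' := by
    intro j k' hk'
    unfold InWindow at hk'
    rcases lt_or_ge k' 0 with h | h
    · obtain ⟨n, rfl⟩ : ∃ n : ℕ, k' = -(n : ℤ) - 1 := ⟨(-k' - 1).toNat, by omega⟩
      rw [hAW n]
      exact hwake j n
    · obtain ⟨n, rfl⟩ : ∃ n : ℕ, k' = (F.W : ℤ) + n := ⟨(k' - F.W).toNat, by omega⟩
      rw [htubeCT, htubeRT, hAT, abs_zero, zero_add]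
  have hAW' : ∀ j : ℕ, A (-(j : ℤ)) ≤ Q * β ^ j := by
    intro j
    cases j with
    | zero => simpa using hQA
    | succ n =>
      have e : (-((n + 1 : ℕ) : ℤ)) = -(n : ℤ) - 1 := by push_cast; ring
      rw [e, hAW n]
  have hAT' : ∀ j : ℕ, A ((F.W : ℤ) - 1 + j) ≤ abart * ϑR ^ j := by
    intro j
    cases j with
    | zero => simpa using hAlast
    | succ n =>
      have e : (F.W : ℤ) - 1 + ((n + 1 : ℕ) : ℤ) = (F.W : ℤ) + n := by push_cast; ring
      rw [e, hAT n]
      calc εR * ϑR ^ n ≤ abart * ϑR * ϑR ^ n := mul_le_mul_of_nonneg_right hεab (pow_nonneg hϑR.le _)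
        _ = abart * ϑR ^ (n + 1) := by ring
  have hrec : ∀ j : ℕ, gHi * F.tubeR (-(j : ℤ) - 1) + κ * gHi ^ (j + 2) ≤ F.tubeR (-(j : ℤ) - 2) := by
    intro j
    have e : (-(j : ℤ) - 2) = -((j + 1 : ℕ) : ℤ) - 1 := by push_cast; ring
    rw [e, htubeRW j, htubeRW (j + 1)]
    push_cast
    exact le_of_eq (by ring)
  have hdevW : ∀ j : ℕ, devC (-(j : ℤ) - 2) ≤ cmax * η / ghat * ghat ^ (j + 2) := by
    intro j
    have e : (-(-(j : ℤ) - 2) - 1).toNat = j + 1 := by omega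
    rw [hdevC]
    simp only
    rw [if_pos (by omega), e]
    exact le_of_eq (by field_simp; ring)
  have hdevT : ∀ j : ℕ, devC ((F.W : ℤ) + j) ≤ 0 := by
    intro j
    rw [hdevC]
    simp only
    rw [if_neg (by omega)]
  have hdev : ∀ w, F.Adm w → ∀ i k, ¬ F.InWindow k → ¬ F.InWindow (k + 1) →
      |gfac (slice (F.fullFamily cert w) (F.decodeTau w)) * F.tubeC i (k + 1) - F.tubeC i k| ≤ devC k := by
    intro w hw i k hk hk1
    rcases F.tail_index_cases₂ hW1 hk hk1 with ⟨j, rfl⟩ | ⟨j, rfl⟩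
    · have e1 : (-(j : ℤ) - 2 + 1) = -(j : ℤ) - 1 := by ring
      have e2 : (-(j : ℤ) - 2) = -((j + 1 : ℕ) : ℤ) - 1 := by push_cast; ring
      have e3 : (-(-(j : ℤ) - 2) - 1).toNat = j + 1 := by omega
      rw [e1, htubeCW i j, hdevC]
      simp only
      rw [if_pos (by omega), e3, e2, htubeCW i (j + 1)]
      have e4 : gfac (slice (F.fullFamily cert w) (F.decodeTau w)) * (ghat ^ (j + 1) * c₀ i) -
          ghat ^ (j + 1 + 1) * c₀ i =
          ghat ^ (j + 1) * ((gfac (slice (F.fullFamily cert w) (F.decodeTau w)) - ghat) * c₀ i) := by ring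
      rw [e4, abs_mul, abs_of_nonneg (pow_nonneg hĝ0.le _), abs_mul]
      calc ghat ^ (j + 1) * (|gfac (slice (F.fullFamily cert w) (F.decodeTau w)) - ghat| * |c₀ i|)
          ≤ ghat ^ (j + 1) * (η * cmax) :=
            mul_le_mul_of_nonneg_left (mul_le_mul (hη w hw) (hc i) (abs_nonneg _) hη0) (pow_nonneg hĝ0.le _)
        _ = cmax * η * ghat ^ (j + 1) := by ring
    · have e1 : ((F.W : ℤ) + j + 1) = (F.W : ℤ) + ((j + 1 : ℕ) : ℤ) := by push_cast; ring
      rw [e1, htubeCT, htubeCT, hdevC]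
      simp only
      rw [if_neg (by omega)]
      simp
  have hwakeTube : ∀ i (n : ℕ), 1 ≤ n → |F.tubeC i (-(n : ℤ))| + F.tubeR (-(n : ℤ)) ≤ Q * β ^ n := by
    intro i n hn
    obtain ⟨n', rfl⟩ : ∃ n', n = n' + 1 := ⟨n - 1, by omega⟩
    have e : (-((n' + 1 : ℕ) : ℤ)) = -(n' : ℤ) - 1 := by push_cast; ring
    rw [e]
    exact hwake i n'
  have htopTube : ∀ i (j : ℕ), |F.tubeC i ((F.W : ℤ) + j)| + F.tubeR ((F.W : ℤ) + j) ≤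
      εR / ϑR ^ F.W * ϑR ^ (F.W + j) := by
    intro i j
    have hne' : ϑR ^ F.W ≠ 0 := pow_ne_zero _ hϑR.ne'
    rw [htubeCT, htubeRT, abs_zero, zero_add, pow_add, ← mul_assoc, div_mul_cancel₀ _ hne']
  have hfirstWS' : cmax * η / ghat * ghat ^ 2 +
      F.τhi * ((S * Q ^ 2 * β ^ 2) * (β ^ 2 * (bigLam ε₀)⁻¹) ^ 2) ≤ κ * gHi ^ 2 := by
    have e : cmax * η / ghat * ghat ^ 2 = cmax * η * ghat := by field_simp
    rw [e]
    exact hfirstWSη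
  exact F.exists_surviving_dssWave_of_windowCert_v5s cert R A devC vmax χbm χem hε hΛ1 hMα hα hW1 hq hq1 hA0
    hAtail hAwin hR0 hS hRW hRT hRBm1 hRBW hg0 hWedge hγedge hZedge hDedge hqX hDwin0 hγ0
    hθ hβ1 hβθ hβΛ hω habar hwtW hAW' hgHi hĝ0.le hĝgHi hσξ hdbar hrec hdevW
    hϑ0 hϑ1 hϑR hϑRϑ hΛϑ hωt habart hwtT hAT' hϑR le_rfl htubeRT hdevT
    hfirstW hfirstWS' hfirstT hfirstTS hrowB hrowT hrow1 h0 hwinIn hdev hA1 hg hQA hwakeTube hϑR hϑRΛ hC₀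
    htopTube hne

end OneShiftFrame

end DSSOneShift

end Summit.NavierStokesRegularity.NavierStokesRegularity.Theorems
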